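import Literature.Analysis.FluidPDE.TwoHalfNavierStokes
import Literature.Analysis.FunctionSpaces.TorusHolderBridge
import Literature.Analysis.FunctionSpaces.TorusWeakNull
import HarnessLib

/-!
# `2½`-dimensional fields: pairings, Hölder norms of horizontal lifts, weak limits of vertical lifts

Topic `Literature/Analysis/FluidPDE` (support file for the `2½`-dimensional assembly of
Cheskidov 2023, Thm. 2.1, second subfamily with `e = 0`,
`Literature/Barriers/AnomalousDissipation/AnomalousDissipationWithoutDissipationAnomalyProofs.lean`),
complementing the accepted `TwoHalfNavierStokes` (classical solutions, energies, `L²` norms of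
`u = (V, R) ∘ π`, `Torus.twoHalf`) with the three identities through which the *planar* clauses of
Cheskidov's construction (§3–§4) are read as the *three-dimensional* clauses of Thm. 2.1:

* `Torus.integral_inner_twoHalf` — `∫_{T³} ⟪(V,R)∘π, (V',R')∘π⟫ = ∫_{T²} (⟪V,V'⟫ + R R')` (the
  power `(f, u) = (g, ṽ)` of the horizontal force `f = (g, 0)`, Lemma 3.2);
* `Torus.eBoundedHolderNorm_twoHalf_zero_right_le` — `‖(G,0)∘π‖_{C^{0,α}(T³)} ≤ ‖G‖_{C^{0,α}(T²)}`
  (the force convergence `f^ν → f` in `C([0,2]; C^α)` from the planar `g^m → g`, p. 10);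
* `Torus.tendsto_integral_inner_twoHalf_zero_left` — vertical lifts `(0, r_a) ∘ π` of scalars
  that are bounded in `L²(T²)` with vanishing Fourier modes converge weakly to `0` in `L²(T³; ℝ³)`
  (the reading of "`u^{ν_j}(t) ⇀ u(t) = 0`, `t ∈ [1,2]`" and of the blow-up (3.10); from the
  accepted `TorusWeakNull` on `T³` and `Torus.mFourierCoeff_comp_planarProj`).

## References

* A. Cheskidov, arXiv:2311.04182 (2023), Thm. 2.1, Lemma 3.2, (3.10), p. 10 (`g^m → g`).
* E. Bruè, C. De Lellis, Comm. Math. Phys. 400 (2023), §3.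
-/

noncomputable section

open MeasureTheory Set Filter UnitAddTorus
open _root_.Topology
open scoped ENNReal NNReal InnerProductSpace
open Literature.Analysis.FunctionSpaces.Torus (twoHalf planarProj planarProjE planarEmbed)

namespace Literature.Analysis.FluidPDE.Torus

open Literature.Analysis.FunctionSpaces

/-- **Pairings of `2½`-dimensional fields**: `∫_{T³} ⟪(V,R)∘π, (V',R')∘π⟫ = ∫_{T²} (⟪V,V'⟫ + R R')`
(pointwise `Torus.inner_twoHalf`, then measure preservation of `π`); with `R' = 0` this is the
identity `(f, u) = (g, v)` for horizontal forces `f = (g, 0)` used in Cheskidov 2023, Lemma 3.2. [cite: Cheskidov2023, Lemma 3.2] -/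
theorem integral_inner_twoHalf {V V' : UnitAddTorus (Fin 2) → EuclideanSpace ℝ (Fin 2)} {R R' : UnitAddTorus (Fin 2) → ℝ}
    (h : AEStronglyMeasurable (fun y => ⟪V y, V' y⟫_ℝ + R y * R' y) volume) :
    ∫ x, ⟪twoHalf V R x, twoHalf V' R' x⟫_ℝ = ∫ y, (⟪V y, V' y⟫_ℝ + R y * R' y) := by
  simp_rw [FunctionSpaces.Torus.inner_twoHalf]
  exact FunctionSpaces.Torus.integral_comp_planarProj h

/-- **Hölder norms of horizontal lifts**: `‖(G, 0) ∘ π‖_{C^{0,r}(T³)} ≤ ‖G‖_{C^{0,r}(T²)}` (the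
planar projection is `1`-Lipschitz for the product metrics and `a ↦ (a, 0)` preserves norms and
distances; `Torus.eBoundedHolderNorm_comp_le_of_lipschitz`, `eBoundedHolderNorm_postcomp_le`).
This turns the planar convergence `g^m → g` in `C([0,1]; C^α(T²))` of Cheskidov 2023, p. 10, into
the convergence of the forces `f^m = (g^m, 0) → f = (g, 0)` of Thm. 2.1. [cite: Cheskidov2023, p. 10 and Thm. 2.1] -/
theorem eBoundedHolderNorm_twoHalf_zero_right_le (r : ℝ≥0) (G : UnitAddTorus (Fin 2) → EuclideanSpace ℝ (Fin 2)) :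
    eBoundedHolderNorm r (twoHalf G 0) ≤ eBoundedHolderNorm r G := by
  have h1 : twoHalf G 0 = ((fun a : EuclideanSpace ℝ (Fin 2) => planarEmbed (a, (0 : ℝ))) ∘ G) ∘ planarProj := rfl
  rw [h1]
  refine (FunctionSpaces.eBoundedHolderNorm_comp_le_of_lipschitz
    FunctionSpaces.Torus.lipschitzWith_planarProj).trans
    (FunctionSpaces.eBoundedHolderNorm_postcomp_le (fun a b => ?_) (fun a => ?_))
  · rw [← map_sub, Prod.mk_sub_mk, sub_zero, ← Real.sqrt_sq (norm_nonneg (planarEmbed _)),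
      FunctionSpaces.Torus.norm_sq_planarEmbed]
    simp
  · rw [← Real.sqrt_sq (norm_nonneg (planarEmbed _)), FunctionSpaces.Torus.norm_sq_planarEmbed]
    simp

/-- **Weak vanishing of vertical lifts from vanishing planar Fourier modes.** If the real scalars
`r a : T² → ℝ` are uniformly bounded in `L²` and all their Fourier coefficients tend to zero along
a filter `l`, then the vertical lifts `(0, r a) ∘ π` converge weakly to zero in `L²(T³; ℝ³)`:
`∫ ⟪(0, r a)(π x), w(x)⟫ dx → 0` for every `w ∈ L²(T³; ℝ³)` (the lift has the Fourier coefficients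
of `r a` at horizontal frequencies and none at the others, `Torus.mFourierCoeff_comp_planarProj`;
then `Torus.tendsto_integral_mul_of_tendsto_mFourierCoeff` on `T³` against the vertical component
of `w`). This is how "`u^{ν_j}(t) ⇀ u(t) = 0` in `L²`, `t ∈ [1,2]`" and the blow-up (3.10) of
Cheskidov 2023 are read on `T³`. [cite: Cheskidov2023, Thm. 2.1 and (3.10)] -/
theorem tendsto_integral_inner_twoHalf_zero_left {α : Type*} {l : Filter α}
    {r : α → UnitAddTorus (Fin 2) → ℝ} {M : ℝ} (hr : ∀ a, MemLp (r a) 2 volume) (hrM : ∀ a, ∫ y, r a y ^ 2 ≤ M)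
    (hcoef : ∀ k : Fin 2 → ℤ, Tendsto (fun a => mFourierCoeff (fun y => (r a y : ℂ)) k) l (𝓝 0))
    {w : UnitAddTorus (Fin 3) → EuclideanSpace ℝ (Fin 3)} (hw : MemLp w 2 volume) :
    Tendsto (fun a => ∫ x, ⟪twoHalf 0 (r a) x, w x⟫_ℝ) l (𝓝 0) := by
  have hw2 : MemLp (fun x => w x 2) 2 volume :=
    (EuclideanSpace.proj (𝕜 := ℝ) (2 : Fin 3)).comp_memLp' hw
  have hr' : ∀ a, MemLp (fun x : UnitAddTorus (Fin 3) => r a (planarProj x)) 2 volume := fun a =>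
    (hr a).comp_measurePreserving FunctionSpaces.Torus.measurePreserving_planarProj
  have hrM' : ∀ a, ∫ x : UnitAddTorus (Fin 3), r a (planarProj x) ^ 2 ≤ M := fun a => by
    have := FunctionSpaces.Torus.integral_comp_planarProj (b := fun y => r a y ^ 2)
      ((hr a).aestronglyMeasurable.pow 2)
    rw [show (fun x : UnitAddTorus (Fin 3) => r a (planarProj x) ^ 2) = fun x => (fun y => r a y ^ 2) (planarProj x)
      from rfl, this]
    exact hrM a
  have hcoef' : ∀ K : Fin 3 → ℤ,
      Tendsto (fun a => mFourierCoeff (fun x : UnitAddTorus (Fin 3) => (r a (planarProj x) : ℂ)) K) l (𝓝 0) := by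
    intro K
    have heq : ∀ a, mFourierCoeff (fun x : UnitAddTorus (Fin 3) => (r a (planarProj x) : ℂ)) K =
        if K (Fin.last 2) = 0 then mFourierCoeff (fun y => (r a y : ℂ)) (fun j : Fin 2 => K (Fin.castSucc j))
        else 0 := fun a =>
      FunctionSpaces.Torus.mFourierCoeff_comp_planarProj (b := fun y => (r a y : ℂ))
        (Complex.continuous_ofReal.comp_aestronglyMeasurable (hr a).aestronglyMeasurable) K
    simp_rw [heq]
    split_ifs with hK
    · exact hcoef _
    · exact tendsto_const_nhds
  have h := FunctionSpaces.Torus.tendsto_integral_mul_of_tendsto_mFourierCoeff hr' hrM' hcoef' hw2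
  refine h.congr fun a => integral_congr_ae (ae_of_all _ fun x => ?_)
  simp only [FunctionSpaces.Torus.inner_twoHalf_left, Pi.zero_apply, inner_zero_left, zero_add]

end Literature.Analysis.FluidPDE.Torus

end
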